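import Mathlib
import Literature.Computability.Complexity.RandomKSatLowDegreeHardness
import Literature.Computability.Complexity.RandomKSatEnsembleOGP
import Summits.PneNP.PneNP.Theorems.OverlapGapAlgebraSearchHardWindowGrandCorrelation
import Summits.PneNP.PneNP.Theorems.OverlapGapAlgebraSearchHardWindowResampleKernelBasic
import Summits.PneNP.PneNP.Theorems.OverlapGapAlgebraSearchHardWindowResamplePositivity
import Summits.PneNP.PneNP.Theorems.OverlapGapAlgebraSearchHardWindowResampleStability
import Summits.PneNP.PneNP.Theorems.OverlapGapAlgebraSearchHardWindowMoat
import Summits.PneNP.PneNP.Theorems.OverlapGapAlgebraSearchHardWindowChainMassBasic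
import Summits.PneNP.PneNP.Theorems.OverlapGapAlgebraSearchHardWindowInstability
import Summits.PneNP.PneNP.Theorems.OverlapGapAlgebraSearchHardWindowMoatTransfer
import Summits.PneNP.PneNP.Theorems.OverlapGapAlgebraSearchHardWindowHsAsymptotics

/-!
# Route OverlapGapAlgebra, crux `SearchHardWindow` (stmt-PneNP-2460), line `Sketch`: assembly of
# Huang–Sellke 2025 Cor. 3.21 (deterministic saturated form) from the resampling-chain obstructions

Stub `stub_hsAssembly` of the skeleton `Summits/PneNP/PneNP/Cruxes/SearchHardWindow/Lines/Sketch.lean`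
(section `HS25`): the named fact `HuangSellke2025KSat` (Huang–Sellke 2025, arXiv:2501.06427,
Cor. 3.21, `κ = 5`, deterministic saturated special case) DERIVED from the first-moment named fact
`HuangSellke2025KSatObstructions` (HS25 Lemmas 3.22–3.23: OGP and CHAOS structures on the
`ε`-resampling chain have mass `≤ e^{-cn}`) by Huang–Sellke's argument (§3.3.2), using the landed
pieces of the line:

* `stub_grandCorrelation` — the grand correlation inequality (HS25 Lemma 3.15): the paths of the
  chain that are good at all times and close at all steps have mass `≥ (p² − u)₊^{2T}`;
* `stub_resampleKernelBasic`, `stub_resamplePositivity` — the resampling kernel is nonnegative,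
  symmetric, stochastic and one-step positive;
* `stub_resampleStability` + `stub_instability` — `L²`-stability of coordinate-degree-`D` functions
  (HS25 Prop. 3.14) and Markov: the one-step mass of "the output moves by more than `θ n`" is
  `≤ u = 2ε(1 + ε m k) D C / θ`;
* `stub_chainMassBasic` — monotonicity / subadditivity of the chain mass, and the identification of
  the all-good-all-close mass with the path sum of the grand correlation lemma;
* `stub_moat` + `stub_moatTransfer` — the deterministic moat (HS25 Lemmas 3.24–3.25): an
  all-good-all-close path carries an OGP structure unless it carries a CHAOS structure;
* `stub_hsAsymptotics` — the parameter bookkeeping: with `1 ≤ D' = o(n)`, `ε = log(n/D')/n`,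
  `W = ⌈1/(b k ε)⌉`, `T = k W`, eventually `ε > 0`, `u ≤ p²/2`, `T ≤ n²` and
  `2 e^{-cn} < (p²/2)^{2T}`.

The proof (`hsA_core`, at one large `n`, by contradiction): if more than `p · #Φ` literal arrays are
"good" (every output coordinate saturated, `|F_v| ≥ 1`, and the sign vector satisfies the
instance), then with `close y y' := ‖F y − F y'‖² ≤ θ n` (`h₂(θ) ≤ η`, `θ ≤ 1/2`,
`hsA_exists_theta`) grand correlation and the chain-mass identity give
`(p²/2)^{2T} ≤ mass(all good ∧ all close)`, the moat gives
`mass(all good ∧ all close) ≤ mass(OGP) + mass(CHAOS) ≤ 2 e^{-cn}`, contradicting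
`2 e^{-cn} < (p²/2)^{2T}`. The final theorem applies the obstructions fact with `b = b₁`,
`D' = D + 1`, the saturated sign map as the output map and chain-length exponent `A = 2`.

References: B. Huang, M. Sellke, *Strong low degree hardness for stable local optima in spin
glasses*, arXiv:2501.06427 (2025), §3.3.2, Cor. 3.21, Lemmas 3.15, 3.22–3.25 [HuangSellke2025];
G. Bresler, B. Huang, FOCS 2021 / arXiv:2106.02129 [BreslerHuang2022].
-/

set_option linter.dupNamespace false -- `Summit.PneNP.PneNP.…`: summit = sub-problem

namespace Summit.PneNP.PneNP.Theorems

open Finset Filter Asymptotics Topology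
open Literature.Computability.Complexity
open scoped Classical

/-! ## Small helpers -/

/-- A small parameter `θ ∈ (0, 1/2]` with binary entropy `h₂(θ) ≤ η`, for any `η > 0`
(continuity of `h₂` at `0`, where `h₂(0) = 0`). -/
theorem hsA_exists_theta {η : ℝ} (hη : 0 < η) :
    ∃ θ : ℝ, 0 < θ ∧ θ ≤ 1 / 2 ∧ Real.binEntropy θ ≤ η := by
  have h : ∀ᶠ x in 𝓝 (0 : ℝ), Real.binEntropy x < η := by
    have ht : Tendsto Real.binEntropy (𝓝 0) (𝓝 0) := by
      simpa only [Real.binEntropy_zero] using Real.binEntropy_continuous.tendsto 0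
    exact ht.eventually_lt_const hη
  obtain ⟨δ, hδ, hball⟩ := Metric.eventually_nhds_iff.1 h
  have hθ0 : 0 < min (1 / 2 : ℝ) (δ / 2) := lt_min (by norm_num) (by linarith)
  refine ⟨min (1 / 2) (δ / 2), hθ0, min_le_left _ _, (hball ?_).le⟩
  rw [Real.dist_eq, sub_zero, abs_of_pos hθ0]
  exact (min_le_right _ _).trans_lt (by linarith)

/-- The resampling rate `ε = log(n / D)/n` is at most `1` for `n, D ≥ 1` (`log x ≤ x - 1`). -/
theorem hsA_eps_le_one (n D : ℕ) (hn : 1 ≤ n) (hD : 1 ≤ D) : Real.log (n / D) / n ≤ 1 := by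
  have hn' : (0 : ℝ) < n := by exact_mod_cast hn
  have hD' : (1 : ℝ) ≤ D := by exact_mod_cast hD
  have h1 : (n : ℝ) / D ≤ n := div_le_self hn'.le hD'
  have h2 : Real.log (n / D) ≤ (n : ℝ) / D - 1 :=
    Real.log_le_sub_one_of_pos (div_pos hn' (by linarith))
  rw [div_le_one hn']
  linarith

/-- `D n + 1 = o(n)` when `D n = o(n)`. -/
theorem hsA_isLittleO_succ (D : ℕ → ℕ)
    (hD : (fun n : ℕ => (D n : ℝ)) =o[atTop] (fun n : ℕ => (n : ℝ))) :
    (fun n : ℕ => ((D n + 1 : ℕ) : ℝ)) =o[atTop] (fun n : ℕ => (n : ℝ)) := by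
  have h1 : (fun _ : ℕ => ((1 : ℕ) : ℝ)) =o[atTop] (fun n : ℕ => (n : ℝ)) := by
    have := (isLittleO_const_id_atTop (1 : ℝ)).comp_tendsto tendsto_natCast_atTop_atTop
    simpa [Function.comp_def] using this
  simpa [Nat.cast_add] using hD.add h1

/-- The failure indicator of a decided proposition: `[decide P = true ↦ 0; 1] = [P ↦ 0; 1]`, for
any `Decidable` instances. -/
theorem hsA_ite_decide {P : Prop} {hP : Decidable P} {hd : Decidable (@decide P hP = true)}
    {hP' : Decidable P} : @ite ℝ (@decide P hP = true) hd 0 1 = @ite ℝ P hP' 0 1 := by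
  by_cases h : P
  · have h' : @decide P hP = true := @decide_eq_true P hP h
    rw [if_pos h', if_pos h]
  · have h' : ¬ @decide P hP = true := fun h'' => h (@of_decide_eq_true P hP h'')
    rw [if_neg h', if_neg h]

/-! ## The core: one large `n`, by contradiction -/

/-- **The core of the assembly at one instance size** (Huang–Sellke 2025 §3.3.2, proof of
Cor. 3.21, deterministic saturated form). Data: a vector-valued `F` on literal arrays
`Fin m → Fin k → Fin n × Bool` whose output coordinates have coordinate degree `≤ D` and whose energy
is `≤ C n #Φ`; a resampling rate `0 < ε ≤ 1`, a closeness scale `θ ∈ (0, 1/2]` with `h₂(θ) ≤ η`,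
the band `0 < η < β`, a gap `W ≥ 1/(b k ε)`, `W > 0`, a horizon `T ≥ k W`, `T ≥ 1`; the
instability level `2ε(1 + ε m k) D C/θ ≤ p²/2`; `2 e^{-cn} < (p²/2)^{2T}`; and the two obstruction
bounds of `HuangSellke2025KSatObstructions` at chain length `T` (OGP and CHAOS masses `≤ e^{-cn}`,
the CHAOS event read with the saturated sign map of `F` as output map). Conclusion: at most
`p · #Φ` literal arrays are saturated-and-sign-solved by `F`. -/
theorem hsA_core (n m k : ℕ) (hn : 1 ≤ n) (F : (Fin m → Fin k → Fin n × Bool) → Fin n → ℝ)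
    (ε θ C β η b c p : ℝ) (D W T : ℕ)
    (hε0 : 0 < ε) (hε1 : ε ≤ 1) (hθ0 : 0 < θ) (hθ : θ ≤ 1 / 2) (hθη : Real.binEntropy θ ≤ η)
    (hη : 0 < η) (hηβ : η < β) (hp : 0 < p) (hW : 0 < W) (hWb : 1 / (b * k * ε) ≤ W)
    (hT : k * W ≤ T) (hT1 : 1 ≤ T)
    (hdeg : ∀ v : Fin n, IsCoordDegreeLE D
      (fun y : Fin m × Fin k → Fin n × Bool => F (Function.curry y) v))
    (hener : ∑ Φ : Fin m → Fin k → Fin n × Bool, ∑ v : Fin n, F Φ v ^ 2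
      ≤ C * n * Fintype.card (Fin m → Fin k → Fin n × Bool))
    (hu : 2 * ε * (1 + ε * (m * k)) * D * C / θ ≤ p ^ 2 / 2)
    (hfin : 2 * Real.exp (-(c * n)) < (p ^ 2 / 2) ^ (2 * T))
    (hOGP : resampleChainMass ε T (fun y : ℕ → (Fin m × Fin k → Fin n × Bool) =>
        ∃ (t : ℕ → ℕ) (x : ℕ → Fin n → Bool), (∀ ℓ < k, t ℓ ≤ t (ℓ + 1)) ∧ t k ≤ T ∧
          (∀ ℓ ≤ k, ∀ i : Fin m, ∃ j : Fin k, x ℓ (y (t ℓ) (i, j)).1 = (y (t ℓ) (i, j)).2) ∧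
          ∀ ℓ, 1 ≤ ℓ → ℓ ≤ k → overlapCondEnt x ℓ ∈ Set.Icc (β - η) β)
      ≤ Real.exp (-(c * n)))
    (hCHAOS : resampleChainMass ε T (fun y : ℕ → (Fin m × Fin k → Fin n × Bool) =>
        ∃ (j : ℕ) (t : ℕ → ℕ) (x : Fin n → Bool), 1 ≤ j ∧ j ≤ k ∧
          (∀ ℓ < j, t ℓ ≤ t (ℓ + 1)) ∧ t j ≤ T ∧ (t (j - 1) : ℝ) + 1 / (b * k * ε) ≤ t j ∧
          (∀ i : Fin m, ∃ j' : Fin k, x (y (t j) (i, j')).1 = (y (t j) (i, j')).2) ∧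
          overlapCondEnt
            (fun ℓ => if ℓ < j then (fun v => decide (0 ≤ F (Function.curry (y (t ℓ))) v)) else x)
            j ≤ β)
      ≤ Real.exp (-(c * n)))
    {hdec : DecidablePred fun Φ : Fin m → Fin k → Fin n × Bool =>
      (∀ v : Fin n, 1 ≤ |F Φ v|) ∧
        ∀ i : Fin m, ∃ j : Fin k, decide (0 ≤ F Φ (Φ i j).1) = (Φ i j).2} :
    ((@Finset.filter _ (fun Φ : Fin m → Fin k → Fin n × Bool =>
        (∀ v : Fin n, 1 ≤ |F Φ v|) ∧
        ∀ i : Fin m, ∃ j : Fin k, decide (0 ≤ F Φ (Φ i j).1) = (Φ i j).2) hdec univ).card : ℝ)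
      ≤ p * Fintype.card (Fin m → Fin k → Fin n × Bool) := by
  haveI : Nonempty (Fin n × Bool) := ⟨(⟨0, hn⟩, true)⟩
  by_contra hcon
  rw [not_le] at hcon
  -- the good set and the closeness relation on the UNCURRIED instance space
  set good : (Fin m × Fin k → Fin n × Bool) → Bool := fun y =>
    decide ((∀ v, 1 ≤ |F (Function.curry y) v|) ∧
      ∀ i : Fin m, ∃ j : Fin k, decide (0 ≤ F (Function.curry y) (y (i, j)).1) = (y (i, j)).2)
    with hgood_def
  set close : (Fin m × Fin k → Fin n × Bool) → (Fin m × Fin k → Fin n × Bool) → Bool :=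
    fun y y' => decide (∑ v, (F (Function.curry y) v - F (Function.curry y') v) ^ 2 ≤ θ * n)
    with hclose_def
  have hcs : ∀ y y', close y y' = close y' y := by
    intro y y'
    have hs : ∑ v, (F (Function.curry y) v - F (Function.curry y') v) ^ 2 =
        ∑ v, (F (Function.curry y') v - F (Function.curry y) v) ^ 2 :=
      Finset.sum_congr rfl fun v _ => by ring
    simp only [hclose_def, hs]
  -- (1) density of the good set: the violated target bound, read through currying
  have hcardS : Fintype.card (Fin m × Fin k → Fin n × Bool) =
      Fintype.card (Fin m → Fin k → Fin n × Bool) :=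
    Fintype.card_congr (Equiv.curry _ _ _)
  have hfilt : (univ.filter fun y : Fin m × Fin k → Fin n × Bool => good y = true).card =
      (@Finset.filter _ (fun Φ : Fin m → Fin k → Fin n × Bool =>
        (∀ v : Fin n, 1 ≤ |F Φ v|) ∧
        ∀ i : Fin m, ∃ j : Fin k, decide (0 ≤ F Φ (Φ i j).1) = (Φ i j).2) hdec univ).card := by
    refine Finset.card_equiv (Equiv.curry (Fin m) (Fin k) (Fin n × Bool)) fun y => ?_
    simp only [Finset.mem_filter, Finset.mem_univ, true_and, hgood_def, decide_eq_true_eq,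
      Equiv.curry_apply, Function.curry_apply]
    exact Iff.rfl
  have hpS : p * Fintype.card (Fin m × Fin k → Fin n × Bool) ≤
      ((univ.filter fun y : Fin m × Fin k → Fin n × Bool => good y = true).card : ℝ) := by
    rw [hcardS, hfilt]
    exact hcon.le
  -- (2) the one-step instability bound (Markov on top of `L²`-stability)
  have hinst := stub_instability n m k hn ε θ C hε0.le hε1 hθ0 D F hener
    (fun v => stub_resampleStability ε hε0.le hε1 (hdeg v))
  have hu' : ∑ y : Fin m × Fin k → Fin n × Bool, ∑ y' : Fin m × Fin k → Fin n × Bool,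
      resampleKernel ε y y' * (if close y y' = true then (0 : ℝ) else 1) ≤
      (2 * ε * (1 + ε * (m * k)) * D * C / θ) * Fintype.card (Fin m × Fin k → Fin n × Bool) := by
    refine le_of_eq_of_le ?_ hinst
    refine Finset.sum_congr rfl fun y _ => Finset.sum_congr rfl fun y' _ => ?_
    simp only [hclose_def]
    congr 1
    exact hsA_ite_decide
  -- (3) grand correlation for the resampling kernel
  obtain ⟨hK0, hKs, hKst⟩ :=
    stub_resampleKernelBasic (ι := Fin m × Fin k) (Γ := Fin n × Bool) ε hε0.le hε1
  have hGC := stub_grandCorrelation (resampleKernel (ι := Fin m × Fin k) (Γ := Fin n × Bool) ε)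
    (fun y y' => hK0 y y') (fun y y' => hKs y y') (fun y => hKst y)
    (fun f => stub_resamplePositivity ε hε0.le hε1 f) good close hcs p
    (2 * ε * (1 + ε * (m * k)) * D * C / θ) hp.le hpS hu' T hT1
  -- (4) chain-mass bookkeeping: `(p²/2)^{2T} ≤ mass(all good ∧ all close)`
  obtain ⟨hmono, hsub, hall⟩ :=
    stub_chainMassBasic (ι := Fin m × Fin k) (Γ := Fin n × Bool) ε hε0.le hε1 T
  have hcardpos : (0 : ℝ) < Fintype.card (Fin m × Fin k → Fin n × Bool) :=
    Nat.cast_pos.2 Fintype.card_pos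
  have hq0 : (0 : ℝ) ≤ p ^ 2 / 2 := by positivity
  have hq : p ^ 2 / 2 ≤ max 0 (p ^ 2 - 2 * ε * (1 + ε * (m * k)) * D * C / θ) :=
    le_max_of_le_right (by linarith)
  have hlow : (p ^ 2 / 2) ^ (2 * T) ≤ resampleChainMass ε T
      (fun z : ℕ → (Fin m × Fin k → Fin n × Bool) =>
        (∀ t ≤ T, good (z t) = true) ∧ ∀ t < T, close (z t) (z (t + 1)) = true) := by
    have h1 := (mul_le_mul_of_nonneg_left (pow_le_pow_left₀ hq0 hq (2 * T)) hcardpos.le).trans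
      (hGC.trans_eq (hall good close).symm)
    exact le_of_mul_le_mul_right (by linarith [h1]) hcardpos
  -- (5) the moat: an all-good-all-close path carries an OGP or a CHAOS structure
  have hincl : ∀ z : ℕ → (Fin m × Fin k → Fin n × Bool),
      ((∀ t ≤ T, good (z t) = true) ∧ ∀ t < T, close (z t) (z (t + 1)) = true) →
      (∃ (t : ℕ → ℕ) (x : ℕ → Fin n → Bool), (∀ ℓ < k, t ℓ ≤ t (ℓ + 1)) ∧ t k ≤ T ∧
          (∀ ℓ ≤ k, ∀ i : Fin m, ∃ j : Fin k, x ℓ (z (t ℓ) (i, j)).1 = (z (t ℓ) (i, j)).2) ∧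
          ∀ ℓ, 1 ≤ ℓ → ℓ ≤ k → overlapCondEnt x ℓ ∈ Set.Icc (β - η) β) ∨
      (∃ (j : ℕ) (t : ℕ → ℕ) (x : Fin n → Bool), 1 ≤ j ∧ j ≤ k ∧
          (∀ ℓ < j, t ℓ ≤ t (ℓ + 1)) ∧ t j ≤ T ∧ (t (j - 1) : ℝ) + 1 / (b * k * ε) ≤ t j ∧
          (∀ i : Fin m, ∃ j' : Fin k, x (z (t j) (i, j')).1 = (z (t j) (i, j')).2) ∧
          overlapCondEnt
            (fun ℓ => if ℓ < j then (fun v => decide (0 ≤ F (Function.curry (z (t ℓ))) v)) else x)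
            j ≤ β) := by
    rintro z ⟨hg, hc⟩
    refine or_iff_not_imp_right.2 fun hch => ?_
    push Not at hch
    have hgood' : ∀ t ≤ T, (∀ v, 1 ≤ |F (Function.curry (z t)) v|) ∧
        ∀ i : Fin m, ∃ j : Fin k,
          decide (0 ≤ F (Function.curry (z t)) (z t (i, j)).1) = (z t (i, j)).2 := by
      intro t ht
      simpa only [hgood_def, decide_eq_true_eq] using hg t ht
    have hclose' : ∀ t < T,
        ∑ v, (F (Function.curry (z t)) v - F (Function.curry (z (t + 1))) v) ^ 2 ≤ θ * n := by
      intro t ht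
      simpa only [hclose_def, decide_eq_true_eq] using hc t ht
    refine stub_moatTransfer stub_moat n m k W T β η θ hW hη hηβ hT hθ hθη hn F z hgood' hclose'
      (fun j t x h1 h2 h3 h4 h5 h6 => hch j t x h1 h2 h3 h4 ?_ h6)
    have h5' : ((t (j - 1) + W : ℕ) : ℝ) ≤ t j := by exact_mod_cast h5
    push_cast at h5'
    linarith [hWb]
  -- (6) conclusion: `(p²/2)^{2T} ≤ mass ≤ mass(OGP) + mass(CHAOS) ≤ 2 e^{-cn} < (p²/2)^{2T}`
  have hupp := (hmono _ _ hincl).trans ((hsub _ _).trans (add_le_add hOGP hCHAOS))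
  linarith [hlow, hupp, hfin]

/-! ## The stub -/

/-- **Huang–Sellke 2025, Cor. 3.21 (deterministic saturated form) from Lemmas 3.22–3.23**
(stub `stub_hsAssembly` of line `Sketch`): the named fact `HuangSellke2025KSat` follows from the
resampling-chain obstructions `HuangSellke2025KSatObstructions` by grand correlation, positivity
and `L²`-stability of the resampling kernel, the moat, and the parameter asymptotics
(`b = b₁`, `D' = D + 1`, output map = saturated sign map, `A = 2`; `ε = log(n/D')/n`,
`W = ⌈1/(b k ε)⌉`, `T = k W`, `p = ε₀`). -/
theorem stub_hsAssembly (hObs : HuangSellke2025KSatObstructions) : HuangSellke2025KSat := by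
  obtain ⟨k₀, hk₀⟩ := hObs
  refine ⟨max k₀ 2, fun k hk C hC D hD F hdeg hener ε₀ hε₀ => ?_⟩
  have hk₀k : k₀ ≤ k := le_of_max_le_left hk
  have hk2 : 2 ≤ k := le_of_max_le_right hk
  have hk1 : 1 ≤ k := le_trans one_le_two hk2
  have hkpos : (0 : ℝ) < k := by exact_mod_cast hk1
  have hα : 0 < 5 * 2 ^ k * Real.log k / k := by
    have hlog : 0 < Real.log k := Real.log_pos (by exact_mod_cast hk2)
    exact div_pos (mul_pos (by positivity) hlog) hkpos
  obtain ⟨β, η, hη, hηβ, b₁, hb₁, hfact⟩ := hk₀ k hk₀k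
  obtain ⟨θ, hθ0, hθ, hθη⟩ := hsA_exists_theta hη
  -- the shifted degree sequence `D' = D + 1 ≥ 1`, still `o(n)`
  obtain ⟨D', hD'D, hD'1, hD'o⟩ : ∃ D' : ℕ → ℕ, (∀ n, D n ≤ D' n) ∧ (∀ n, 1 ≤ D' n) ∧
      (fun n : ℕ => (D' n : ℝ)) =o[atTop] (fun n : ℕ => (n : ℝ)) :=
    ⟨fun n => D n + 1, fun n => Nat.le_succ _, fun n => Nat.le_add_left 1 (D n),
      hsA_isLittleO_succ D hD⟩
  -- the obstructions for the saturated sign map of `F`, chain lengths `≤ n ^ 2`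
  obtain ⟨c, hc, hEv⟩ := hfact b₁ hb₁ le_rfl D' hD'o hD'1
    (fun n m y v => decide (0 ≤ F n m (Function.curry y) v)) 2
  -- the parameter asymptotics
  have hAsy := stub_hsAsymptotics k hk1 (5 * 2 ^ k * Real.log k / k) b₁ c C θ ε₀ hα hb₁ hc hC
    hθ0 hε₀ D' hD'o hD'1
  filter_upwards [hEv, hAsy, eventually_ge_atTop 1] with n hEvn hAsyn hn m hm
  obtain ⟨ε, hεdef⟩ : ∃ ε : ℝ, ε = Real.log (n / D' n) / n := ⟨_, rfl⟩
  rw [← hεdef] at hAsyn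
  obtain ⟨-, hεpos, hu, hT2, hfin⟩ := hAsyn
  obtain ⟨hOGP, hCHAOS⟩ := hEvn m hm ε hεdef _ hT2
  subst hm
  have hε1 : ε ≤ 1 := by
    rw [hεdef]
    exact hsA_eps_le_one n (D' n) hn (hD'1 n)
  have hW : 0 < ⌈1 / (b₁ * k * ε)⌉₊ :=
    Nat.ceil_pos.2 (div_pos one_pos (mul_pos (mul_pos hb₁ hkpos) hεpos))
  have hT1 : 1 ≤ k * ⌈1 / (b₁ * k * ε)⌉₊ :=
    Nat.one_le_iff_ne_zero.2 (Nat.mul_ne_zero (by omega) hW.ne')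
  exact hsA_core n _ k hn (F n _) ε θ C β η b₁ c ε₀ (D' n) ⌈1 / (b₁ * k * ε)⌉₊
    (k * ⌈1 / (b₁ * k * ε)⌉₊) hεpos hε1 hθ0 hθ hθη hη hηβ hε₀ hW (Nat.le_ceil _) le_rfl hT1
    (fun v => (hdeg n _ v).mono (hD'D n)) (hener n _ rfl) hu hfin hOGP hCHAOS

end Summit.PneNP.PneNP.Theorems
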